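import Mathlib
import Summits.Ventures.PercRepro2.K5HyperK3CmpB

/-!
# THE `M-TRI` CERTIFICATES OF THE CRUX KERNEL AT THE COINCIDENCE `b = a₃` (marking `b = 3`), PART 5
(blind cell PercRepro2, typer-1 g11; mine-1 §23.12 at the three `MarksDistinct` markings; twin `k5hyper_k3cmp_b_typer.py 3`)

`CertLE (kNegM3b 3 (triMask T) (pairMask e)) (kPosM3b 3 …)`: `N(K₅ + T(1) + e(1)) ≥ N(K₅ + T(1))` for the (TRI) kernel `K₃`
at the marking `(0, 1, 2, 3, 3)`, every `K₅` profile (`240` products of three Kronecker numbers; base `2^23`).  One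
`decide +kernel` each under `maxHeartbeats 0` (the kernel's deterministic timeout is the wall — the rule of record of g10).
-/

namespace Summit.Ventures.PercRepro2

namespace K5

set_option maxRecDepth 100000 in
set_option maxHeartbeats 0 in
/-- `M-TRI ≥ 0` at the marking `b = 3` on the triangle `T = {1, 2, 3}`, pair `e = {2, 3}`. -/
theorem cert_M3b3_123_23 :
    CertLE (kNegM3b 3 (triMask 1 2 3) (pairMask 2 3))
      (kPosM3b 3 (triMask 1 2 3) (pairMask 2 3)) := by
  unfold CertLE
  decide +kernel

set_option maxRecDepth 100000 in
set_option maxHeartbeats 0 in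
/-- `M-TRI ≥ 0` at the marking `b = 3` on the triangle `T = {1, 2, 4}`, pair `e = {1, 2}`. -/
theorem cert_M3b3_124_12 :
    CertLE (kNegM3b 3 (triMask 1 2 4) (pairMask 1 2))
      (kPosM3b 3 (triMask 1 2 4) (pairMask 1 2)) := by
  unfold CertLE
  decide +kernel

set_option maxRecDepth 100000 in
set_option maxHeartbeats 0 in
/-- `M-TRI ≥ 0` at the marking `b = 3` on the triangle `T = {1, 2, 4}`, pair `e = {1, 4}`. -/
theorem cert_M3b3_124_14 :
    CertLE (kNegM3b 3 (triMask 1 2 4) (pairMask 1 4))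
      (kPosM3b 3 (triMask 1 2 4) (pairMask 1 4)) := by
  unfold CertLE
  decide +kernel

set_option maxRecDepth 100000 in
set_option maxHeartbeats 0 in
/-- `M-TRI ≥ 0` at the marking `b = 3` on the triangle `T = {1, 2, 4}`, pair `e = {2, 4}`. -/
theorem cert_M3b3_124_24 :
    CertLE (kNegM3b 3 (triMask 1 2 4) (pairMask 2 4))
      (kPosM3b 3 (triMask 1 2 4) (pairMask 2 4)) := by
  unfold CertLE
  decide +kernel

set_option maxRecDepth 100000 in
set_option maxHeartbeats 0 in
/-- `M-TRI ≥ 0` at the marking `b = 3` on the triangle `T = {1, 3, 4}`, pair `e = {1, 3}`. -/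
theorem cert_M3b3_134_13 :
    CertLE (kNegM3b 3 (triMask 1 3 4) (pairMask 1 3))
      (kPosM3b 3 (triMask 1 3 4) (pairMask 1 3)) := by
  unfold CertLE
  decide +kernel

end K5

end Summit.Ventures.PercRepro2
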